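import Summits.BirchSwinnertonDyer.Rank1Residual.O6.X3KatoMemberBoundOfHullReadings
import Literature.NumberTheory.EllipticCurves.Kato2004.HullDescentEqualityProofs
import HarnessLib

/-!
# O6 / X3 and the Kato descent at an ARBITRARY member: the EXACT rank-`0` count
# `ord_p #Ш_an(W) = ord_p #Ш(W)[p^∞] + m(W)` (`p^m` = Kato's `μ`) and `KMC_p ⟺ BSD_p` at every
# hull-realised member (cell `bsd-potss`, seat `kmc`, generation 7; part 14 of the descent files;
# consequences for the upper half in the sibling `X3KatoMemberBoundExactCountUpper.lean`)

HONEST FRAMING (cell `bsd-potss`, `run/shared/lean/pub/bsd-potss/`, FULL-BSD rank-`≤ 1` programme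
tranche 1b, rows B5 = O6 wild `3` and B4 (t′), routes `KatoDescentPotSupersingular` /
`KatoDescentTamePotSupersingular`): NOTHING about Kato's objects is asserted and no Literature fact is
minted. As in parts 11–12 (`X3KatoMemberBoundOfHullReadings`), Kato's `Λ`-modules enter through the
interface `KatoHullDescentDatum p` + the interface predicate `IsHullOf` (a section variable; a
D-O6-2-type definition request) and the printed theorems about them as HYPOTHESIS SCHEMATA with
locators (§2). §4 is CONDITIONAL over displayed readings / named facts; no route item is closed;
census numbers are not inputs; nothing is booked.

## The mathematics (memo v6 §2 of `HOME/bsd-potss-kmc/KMC-DESCENT-MEMO-v6.md`)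

Let `p ≠ 2` be additive and potentially good for `E/ℚ` (any image, any rational torsion,
`p^t = #E(ℚ)[p^∞]`), `L(E,1) ≠ 0`, `T = T_pE`, and `A = H¹(ℤ[1/p],T)` in Kato's sense (8.2: étale
cohomology of `Spec ℤ[1/p]` with `j_*`, i.e. classes UNRAMIFIED at every `ℓ ≠ p`). Part 12's Reading M3
took Prop. 14.16 (2) at face value, `#S(T) = μ⁻¹·ν·#H⁰(ℚ,T⊗ℚ/ℤ)·#H⁰(ℚ,T*(1)⊗ℚ/ℤ) = μ⁻¹ν p^{2t}`, and
bounded the cokernel in Lemma T (`[S(T) : Sel]·#coker = ∏_{ℓ≠p} c_ℓ^{(p)}`) by `p^t` separately —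
whence the slack `3t` of T-X3K. The two corrections CANCEL: (i) the factor `#H⁰(ℚ,T⊗ℚ/ℤ)` enters
Kato's proof (p. 244, last lines) as `#H¹_f(ℤ[1/p],T) = #H¹(ℤ[1/p],T)_tors`, which for `j_*`-cohomology
is the set of `P ∈ E(ℚ)[p^∞]` whose Bockstein class is UNRAMIFIED at every `ℓ ≠ p` (`P ∈ E⁰(ℚ_ℓ)`),
of order `p^{t₁} ≤ p^t` (strictly smaller e.g. for 50b1 at `p = 5`), so `#S(T) = μ⁻¹ ν p^{t₁+t}`;
(ii) by Poitou–Tate for the pair of Selmer structures `Sel ⊂ S(T)` (Mazur–Rubin Thm. 2.3.4; local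
conditions `0` versus `H¹_ur(ℚ_ℓ,E[p^∞])` at `ℓ ≠ p`, exact annihilators `H¹(ℚ_ℓ,T)` versus
`H¹_ur(ℚ_ℓ,T)`) the cokernel is dual to `Sel(ℚ,T_pE)/H¹_f(ℤ[1/p],T) = δ(E(ℚ)[p^∞])/A_tors`, of order
EXACTLY `p^{t−t₁}`. Hence `#Ш[p^∞]·∏_{ℓ≠p} c_ℓ^{(p)} = μ⁻¹ ν p^{2t}` and, with
`ord_p ν = ord_p(L(E,1)/Ω) − v_p(c_p)` (local index at an additive `p`, Kim AJM 2026 §3.2.3; Thm. 12.5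
(1)): **`ord_p #Ш(E)[p^∞] + v_p(Tam E) + m = ord_p(L(E,1)/Ω_E) + 2t`**, i.e.
**`ord_p #Ш_an(E) = ord_p #Ш(E) + m`**, EXACTLY, at every member, where `μ = p^m = [A : z]/#H²(ℤ[1/p],T)`
(`z` in the hull, `[A : z] = [A : y]·p^{−e}`). By the hull descent (`HullDescentEqualityProofs`)
`m = e(F/Λz) − e(𝐇²(T)⁰)`: `m ≥ 0` under the divisibility for the hull and `m = 0` iff Conj. 12.10 holds
on this component — so `KMC_p(W) ⟺ BSD_p(W)` at EVERY member carrying a realised hull datum (no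
torsion-free member, no Mazur–Kenku walk, no isogeny transport), and the upper half holds AT Kato's
member with no slack (sibling file: T-X3K♯ / (I-X3t)♭ / the U₀ reducible-defect children).

## Contents
* §1 `KatoHullDescentDatum.Conj1210`, `D.muExp` and the kernel dictionary (`muExp = e(F/Λz) − e(H2)`,
  `0 ≤ muExp` under the hull divisibility, `Conj1210 ↔ muExp = 0`).
* §2 READING M3♯ `KatoHull.ExactCountReading IsHullOf` (it implies part 12's Reading M3) and the
  interface lemma `KatoHull.ReadsKMC IsHullOf KMC`.
* §3 bookkeeping `exists_shaAn_eq_of_exactCount`.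
* §4 `KatoHull.exists_shaAn_eq_of_reading` (the defect identity), `KatoHull.missingUpperBoundAt_of_exactCount`
  (upper half at the realised member), `KatoHull.bsdp_of_kmc` / `kmc_of_bsdp` / `kmc_iff_bsdp`.

WHAT THIS IS NOT. Not a proof of any route item or typed node (conditional, audit `proof.conditional`);
not a construction of `𝐇^q(T)`, `z_γ`, the hull, Kato's member or `H^q(ℤ[1/p],T)` (interfaces; D-O6-2
stands); not the LOWER half (that is KMC); nothing at `p = 2` or at a potentially multiplicative `p`.

References: K. Kato, Astérisque 295 (2004): 8.2 (p. 180), Thm. 12.4–12.6, Remark 12.7 (pp. 221–222),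
Conj. 12.10 (p. 224), 13.14 (p. 234), §14.1 (pp. 234–235), Thm. 14.5 and `[M : z]` (pp. 236–237), §14.8
(p. 238), (14.9.3)–(14.9.4) (p. 240), §14.14 and Lemma 14.15 (pp. 243–244), Prop. 14.16 and its proof
(pp. 244–245) [Kato2004Asterisque]; B. Mazur, K. Rubin, Mem. AMS 799 (2004) Thm. 2.3.4 [MazurRubin2004];
K. Rubin, *Euler Systems* (2000) Thm. 1.7.3, Prop. 1.4.3 [Rubin2000]; C. Wuthrich, Doc. Math. 19 (2014)
§3.2–3.4, Lemma 14 [Wuthrich2014]; R. Greenberg, LNM 1716 (1999) §3–4 [GreenbergLNM1716]; C.-H. Kim,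
AJM 148 (2026) §3.2.3 [Kim2022StructureSelmer]; R. L. Miller, LMS JCM 14 (2011) Def. 1.1 [Miller2011LMS].
-/

set_option autoImplicit false

noncomputable section

open scoped Classical

open WeierstrassCurve Literature.NumberTheory.EllipticCurves
  Literature.NumberTheory.EllipticCurves.ModularForms
  Literature.NumberTheory.EllipticCurves.Rank1Residual
  Literature.NumberTheory.EllipticCurves.Rank1Residual.Typed
  Literature.NumberTheory.EllipticCurves.IwasawaAlgebra

namespace Summit.BirchSwinnertonDyer.Rank1Residual.Additive

/-! ## §1 Conj. 12.10 and Kato's `μ`-exponent on the hull datum (kernel dictionary) -/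

namespace KatoHullDescentDatum

variable {p : ℕ} [Fact p.Prime] (D : KatoHullDescentDatum p)

/-- **Kato's Conjecture 12.10 read on the hull datum**: `length_{Λ_𝔮}(𝐇²(T)⁰)_𝔮 = length_{Λ_𝔮}(F/Λz)_𝔮`
at every height-one prime `𝔮` of `Λ` (`F = (𝐇¹(T)⁰)^{**}` differs from `𝐇¹(T)⁰` by a pseudo-null
module, so this is 12.10 on the `Δ`-trivial component). A predicate on the datum; nothing asserted.
[cite: Kato2004Asterisque, Conj. 12.10 (p. 224)] [cite: Wuthrich2014, §3.2 (p. 394)] -/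
def Conj1210 : Prop :=
  ∀ 𝔮 : PrimeSpectrum (IwasawaAlgebra p), 𝔮.asIdeal.height = 1 →
    Module.lengthAt (IwasawaAlgebra p) D.H2 𝔮 =
      Module.lengthAt (IwasawaAlgebra p) (D.F ⧸ (IwasawaAlgebra p) ∙ D.z) 𝔮

/-- **Kato's exponent `m = ord_p μ`**, `μ = [A : z]/#H²(ℤ[1/p],T) = [A : y]·p^{−e}/#(H2/XH2)`
(Prop. 14.16 (2)), as the integer `ord_p [A : y] − e − ord_p #(H2/XH2)`.
[cite: Kato2004Asterisque, Prop. 14.16 (2) (p. 244), `[M : z]` (pp. 236–237)] -/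
def muExp : ℤ :=
  (padicValNat p D.yIndex : ℤ) - D.e - padicValNat p D.h2Card

/-- **`m = e(F/Λz) − e(𝐇²(T)⁰)`** (the `Γ`-Euler exponents of Lemma 14.15), whenever `H2/XH2` is finite
and `[A : y] ≠ 0` — the exact index through the hull (`Kato2004.padicValNat_index_eq_of_hull`); no
divisibility input. [cite: Kato2004Asterisque, §14.14 and Lemma 14.15 (pp. 243–244)] -/
theorem muExp_eq_eulerExp_sub (hfin : Finite (coinvariants p D.H2)) (hne : D.yIndex ≠ 0) :
    D.muExp = (eulerExp p (D.F ⧸ (IwasawaAlgebra p) ∙ D.z) : ℤ) - eulerExp p D.H2 := by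
  have h := Kato2004.padicValNat_index_eq_of_hull D.j D.j_injective D.finite_coker D.z D.z_ne_zero
    D.isTorsion_quotient D.isTorsion_H2 D.y D.e D.j_y D.ι D.π D.ι_injective D.π_surjective
    D.exact_ι_π hfin hne
  unfold muExp yIndex h2Card at *
  linarith

/-- **`m ≥ 0` under the divisibility for the hull** (Kato's `μ ≥ 1`; part 11).
[cite: Kato2004Asterisque, Thm. 12.5 (3)–(4) (p. 222), Thm. 14.5 (3) (p. 236)] [cite: Wuthrich2014, Lemma 14 (p. 396)] -/
theorem muExp_nonneg_of_hullDivisibility (hdiv : D.HullDivisibility)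
    (hfin : Finite (coinvariants p D.H2)) (hne : D.yIndex ≠ 0) : 0 ≤ D.muExp := by
  have h := D.le_padicValNat_yIndex hdiv hfin hne
  unfold muExp
  have h' : (D.e : ℤ) + (padicValNat p D.h2Card : ℤ) ≤ (padicValNat p D.yIndex : ℤ) := by
    exact_mod_cast h
  linarith

/-- **Conj. 12.10 on the hull ⇒ `m = 0`** (the descent of the Main Conjecture through the hull,
`Kato2004.index_eq_pow_mul_natCard_coinvariants_of_hull_of_lengthAt_eq`).
[cite: Kato2004Asterisque, Conj. 12.10 (p. 224), §14.14 (p. 243)] -/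
theorem muExp_eq_zero_of_conj1210 (hMC : D.Conj1210) (hfin : Finite (coinvariants p D.H2))
    (hne : D.yIndex ≠ 0) : D.muExp = 0 := by
  rw [D.muExp_eq_eulerExp_sub hfin hne, Kato2004.eulerExp_eq_of_lengthAt_eq hMC]
  ring

/-- **`m = 0` and the divisibility for the hull ⇒ Conj. 12.10 on the hull** (the converse descent,
`Kato2004.lengthAt_eq_of_index_eq_pow_mul_natCard_coinvariants_of_hull`): `[A : y]/#(H2/XH2)` is a
power of `p` (`= p^{e(F/Λz)+e−e(H2)}`), so `m = 0` forces `[A : y] = p^e·#(H2/XH2)`.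
[cite: Kato2004Asterisque, Thm. 12.5 (3)–(4) (p. 222), Conj. 12.10 (p. 224), §14.14 (p. 243)] -/
theorem conj1210_of_muExp_eq_zero (hdiv : D.HullDivisibility) (hfin : Finite (coinvariants p D.H2))
    (hne : D.yIndex ≠ 0) (h0 : D.muExp = 0) : D.Conj1210 := by
  haveI := hfin
  -- `e(F/Λz) = e(H2)`
  have hE : eulerExp p (D.F ⧸ (IwasawaAlgebra p) ∙ D.z) = eulerExp p D.H2 := by
    have h := D.muExp_eq_eulerExp_sub hfin hne
    rw [h0] at h
    omega
  -- hence `[A : y] = p^e · #(H2/XH2)`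
  have hA := Kato2004.index_eq_natCard_invariants_mul_pow_of_hull D.j D.j_injective D.finite_coker
    D.z D.z_ne_zero D.isTorsion_quotient D.y D.e D.j_y D.ι D.π D.ι_injective D.π_surjective
    D.exact_ι_π hne
  obtain ⟨-, hcard2⟩ := Kato2004.natCard_coinvariants_eq_of_finite D.H2 D.isTorsion_H2 hfin
  have hμ : D.yIndex = p ^ D.e * D.h2Card := by
    unfold yIndex h2Card
    rw [hA, hcard2, hE, pow_add]
    ring
  exact Kato2004.lengthAt_eq_of_index_eq_pow_mul_natCard_coinvariants_of_hull D.j D.j_injective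
    D.finite_coker D.z D.z_ne_zero D.isTorsion_quotient D.isTorsion_H2 hdiv D.y D.e D.j_y D.ι D.π
    D.ι_injective D.π_surjective D.exact_ι_π hfin hμ

/-- **Conj. 12.10 on the hull ⟺ `m = 0`**, granted the divisibility for the hull.
[cite: Kato2004Asterisque, Conj. 12.10 (p. 224), Thm. 14.5 (3) (p. 236)] -/
theorem conj1210_iff_muExp_eq_zero (hdiv : D.HullDivisibility) (hfin : Finite (coinvariants p D.H2))
    (hne : D.yIndex ≠ 0) : D.Conj1210 ↔ D.muExp = 0 :=
  ⟨fun h ↦ D.muExp_eq_zero_of_conj1210 h hfin hne, D.conj1210_of_muExp_eq_zero hdiv hfin hne⟩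

end KatoHullDescentDatum

/-! ## §2 The readings (hypothesis schemata over the interface predicate; nothing asserted) -/

namespace KatoHull

section Readings

variable (IsHullOf : ∀ (W : WeierstrassCurve ℚ) [W.IsElliptic] [W.IsGloballyMinimal] (p : ℕ)
  [Fact p.Prime], KatoHullDescentDatum p → Prop)
variable (KMC : ∀ (W : WeierstrassCurve ℚ) [W.IsElliptic] [W.IsGloballyMinimal] (p : ℕ), Prop)

/-- **READING M3♯ — the EXACT rank-`0` count at an ARBITRARY member** (any image, any rational torsion).
For `W/ℚ` globally minimal, `p ≠ 2` additive potentially good, `L(E,1) ≠ 0`, `Ш(E)` finite and a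
realised hull datum `D` of `W`, with `p^t = #W(ℚ)[p^∞]` and `L(E,1)/Ω(W) = q ∈ ℚ`: `H²(ℤ[1/p],T)` is
finite and `[A : y] ≠ 0` (Thm. 14.5 (1)–(2)), and
**`ord_p #Ш(E)(p) + v_p(Tam E) + ord_p [A : y] = ord_p q + e + ord_p #H²(ℤ[1/p],T) + 2t`**.
Derivation (memo v6 §2): (E1) the exact sequence (14.9.3) for `K = ℚ`, `p ≠ 2`; (E2)
`A = H¹(ℤ[1/p],T)` has rank one and `H²(ℤ[1/p],T)` is finite (Thm. 14.5 (1), image-free); (E3)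
`H¹_f(ℤ[1/p],T) = A_tors` (`A/A_f` is torsion free of rank one: `exp* loc_p z ≠ 0`, 14.13); (E4) with
`H^q(ℤ[1/p],·) = H^q_ét(j_*·)` (8.2), `#A_tors = p^{t₁}` counts the rational `p`-power torsion whose
Bockstein class is unramified at every `ℓ ≠ p`; (E5) counting (14.9.3) with Kato's generalized indices
(`[A : z] = #A_tors·[A/A_tors : z̄]`) gives `#S(T*(1)) = μ⁻¹·ν·p^{t₁}·#H⁰(ℤ[1/p],T*(1)⊗ℚ/ℤ)`,
`#H⁰ = #E(ℚ)[p^∞] = p^t`, and `#S(T) = #S(T*(1))` (14.16 (1)) — this is Prop. 14.16 (2) with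
`#H⁰(ℚ,T⊗ℚ/ℤ)` replaced by `#H¹(ℤ[1/p],T)_tors` (they agree under (12.5.2), where both are `1`);
(E6) Poitou–Tate for the Selmer structures `Sel ⊂ S(T)` on `E[p^∞]` (`0` versus `H¹_ur(ℚ_ℓ,E[p^∞])`
at `ℓ ≠ p`, `#H¹_ur(ℚ_ℓ,E[p^∞]) = c_ℓ^{(p)}`; dual structures `H¹(ℚ_ℓ,T)` versus `H¹_ur(ℚ_ℓ,T)`, exact
annihilators): `[S(T) : Sel]·#coker = ∏_{ℓ≠p} c_ℓ^{(p)}` with `coker ≅ (Sel(ℚ,T_pE)/H¹_f(ℤ[1/p],T))^∨`,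
`Sel(ℚ,T_pE) = δ(E(ℚ)[p^∞])` in rank `0` with `Ш[p^∞]` finite, so `#coker = p^{t−t₁}`; (E7)
`#Sel = #Ш[p^∞]` (§14.1); (E8) `ν = [H¹(ℚ_p,T)/H¹_f : z]·#H²(ℚ_p,T)⁻¹ = p^{ord_p q − v_p(c_p)}`
(`exp*_ω H¹_{/f}(ℚ_p,T) = p^{v_p(c_p)−τ}ℤ_p`: `log_ω E₁(ℚ_p) = pℤ_p`, `[E(ℚ_p):E₁(ℚ_p)] = c_p·p`,
`E₁` torsion free, `p^τ = #E(ℚ_p)[p^∞] = #H²(ℚ_p,T)`; `exp*(z) = L(E,1)/Ω`, Thm. 12.5 (1), no Euler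
factor at an additive `p`); (E9) multiply: `#Ш·∏_{ℓ≠p}c_ℓ^{(p)} = μ⁻¹ ν p^{2t}`, `t₁` cancels. With
`μ = [A : y]·p^{−e}/#H²(ℤ[1/p],T)` this is the display. = part 12's Reading M3 with `≤ … + 3t`
sharpened to `= … + 2t` (`countReading_of_exactCountReading`). Hypothesis schema; nothing asserted.
[cite: Kato2004Asterisque, 8.2 (p. 180), Thm. 14.5 (1)–(2) (p. 236), (14.9.3) (p. 240), Prop. 14.16 and proof (pp. 244–245), §14.8 (p. 238), §14.1 (pp. 234–235), Thm. 12.5 (1) (p. 221)]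
[cite: MazurRubin2004, Thm. 2.3.4] [cite: Rubin2000, Thm. 1.7.3 and Prop. 1.4.3]
[cite: GreenbergLNM1716, §3 after Lemma 3.3 and Prop. 4.13] [cite: Kim2022StructureSelmer, §3.2.3 display before Thm. 3.7 (PDF p. 16)] -/
def ExactCountReading : Prop :=
  ∀ (W : WeierstrassCurve ℚ) [W.IsElliptic] [W.IsGloballyMinimal] (p : ℕ) [Fact p.Prime]
    (D : KatoHullDescentDatum p),
    p ≠ 2 → Addv W p → 0 ≤ padicValRat p W.j →
    W.entireLFunction 1 ≠ 0 → Finite W.sha → IsHullOf W p D →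
    Finite (coinvariants p D.H2) ∧ D.yIndex ≠ 0 ∧
      ∃ q : ℚ, W.entireLFunction 1 / (W.realPeriodRat : ℂ) = (q : ℂ) ∧
        (padicValNat p (Nat.card (AddCommGroup.primaryComponent W.sha p)) : ℤ) +
            padicValNat p W.tamagawaProduct + padicValNat p D.yIndex =
          padicValRat p q + D.e + padicValNat p D.h2Card + 2 * (padicValNat p W.torsionOrder : ℤ)

/-- **INTERFACE LEMMA — what `KMC W p` means on a realised hull datum**: Kato's Conj. 12.10 for `T_pW`
on the `Δ`-trivial component (`KMC W p ↔ D.Conj1210`; the hull `F` and `𝐇¹(T)⁰` have the same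
characteristic ideals). Both sides are interfaces (D-O6-2 is not constructed). Hypothesis schema;
nothing asserted. [cite: Kato2004Asterisque, Conj. 12.10 (p. 224)] -/
def ReadsKMC : Prop :=
  ∀ (W : WeierstrassCurve ℚ) [W.IsElliptic] [W.IsGloballyMinimal] (p : ℕ) [Fact p.Prime]
    (D : KatoHullDescentDatum p), IsHullOf W p D → (KMC W p ↔ D.Conj1210)

/-- **Reading M3♯ implies part 12's Reading M3** (`= … + 2t` ⇒ `≤ … + 3t`): the sharpened schema is a
strengthening, so every consumer of `KatoHull.CountReading` runs on it. [cite: Kato2004Asterisque, Prop. 14.16 (2) (p. 244)] -/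
theorem countReading_of_exactCountReading (hC : ExactCountReading IsHullOf) :
    CountReading IsHullOf := by
  intro W _ _ p _ D hp hadd hj hL hfin hDof
  obtain ⟨hfin2, hne, q, hq, hcount⟩ := hC W p D hp hadd hj hL hfin hDof
  refine ⟨hfin2, hne, q, hq, ?_⟩
  have ht : (0 : ℤ) ≤ (padicValNat p W.torsionOrder : ℤ) := by positivity
  linarith

end Readings

end KatoHull

/-! ## §3 Bookkeeping: `#Ш_an` from the exact count -/

section Bookkeeping

variable (W : WeierstrassCurve ℚ) [W.IsElliptic] (p : ℕ) [Fact p.Prime]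

/-- **The exact count in Miller's currency.** For `W/ℚ` of analytic rank `0` (so `L(W,1) ≠ 0` by
modularity and `Reg = 1`, `Ш` finite by GZK), `L(W,1)/Ω = q ∈ ℚ` and an identity
`ord_p #Ш(p) + v_p(Tam) + a = ord_p q + b + 2·ord_p #tors` (`a, b ∈ ℤ`; for the exact count
`a − b = m`): `#Ш_an = q·#tors²/Tam ∈ ℚ` (`shaAn_def`) and **`ord_p #Ш_an = ord_p #Ш + (a − b)`**.
Bookkeeping. [cite: Miller2011LMS, Def. 1.1 (arXiv:1010.2431 p. 3)] [cite: Darmon2004, Thm. 3.22] -/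
theorem exists_shaAn_eq_of_exactCount (hGZK : rank_eq_analyticRank_of_analyticRank_le_one)
    (hmod : hasEntireLFunction_rat) (hr : W.analyticRank = 0) {q : ℚ} {a b : ℤ}
    (hq : W.entireLFunction 1 / (W.realPeriodRat : ℂ) = (q : ℂ))
    (hcount : (padicValNat p (Nat.card (AddCommGroup.primaryComponent W.sha p)) : ℤ) +
        padicValNat p W.tamagawaProduct + a =
      padicValRat p q + b + 2 * (padicValNat p W.torsionOrder : ℤ)) :
    ∃ q' : ℚ, shaAn W = (q' : ℂ) ∧
      padicValRat p q' = (padicValNat p W.shaOrder : ℤ) + (a - b) := by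
  obtain ⟨hmw, hfin⟩ := hGZK W (by rw [hr]; exact zero_le_one)
  haveI : Finite W.sha := hfin
  have hmw0 : W.mordellWeilRank = 0 := by rw [hmw, hr]
  have hΩ : (W.realPeriodRat : ℂ) ≠ 0 := by exact_mod_cast W.realPeriodRat_pos_holds.ne'
  have hc0 : 0 < W.tamagawaProduct := W.tamagawaProduct_pos_holds
  have ht0 : 0 < W.torsionOrder := W.torsionOrder_pos_holds
  have hL : W.entireLFunction 1 ≠ 0 := (W.analyticRank_eq_zero_iff_holds (hmod W)).mp hr
  have hq0 : q ≠ 0 := by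
    rintro rfl
    rw [Rat.cast_zero, div_eq_zero_iff] at hq
    exact hq.elim hL hΩ
  have ht : (W.torsionOrder : ℚ) ≠ 0 := by exact_mod_cast ht0.ne'
  have hcq : (W.tamagawaProduct : ℚ) ≠ 0 := by exact_mod_cast hc0.ne'
  refine ⟨q * (W.torsionOrder : ℚ) ^ 2 / (W.tamagawaProduct : ℚ), ?_, ?_⟩
  · have hLq : W.entireLFunction 1 = (q : ℂ) * (W.realPeriodRat : ℂ) := by
      rw [← hq, div_mul_cancel₀ _ hΩ]
    rw [shaAn_def, leadingLCoeff_eq_of_analyticRank_eq_zero W hr,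
      W.regulator_eq_one_of_rank_zero hmw0, hLq]
    push_cast
    field_simp
  · have hsha : padicValNat p (Nat.card (AddCommGroup.primaryComponent W.sha p)) =
        padicValNat p W.shaOrder := by
      unfold WeierstrassCurve.shaOrder
      exact padicValNat_card_addPrimaryComponent p
    have hv : padicValRat p (q * (W.torsionOrder : ℚ) ^ 2 / (W.tamagawaProduct : ℚ)) =
        padicValRat p q + 2 * (padicValNat p W.torsionOrder : ℤ) -
          (padicValNat p W.tamagawaProduct : ℤ) := by
      rw [padicValRat.div (mul_ne_zero hq0 (pow_ne_zero 2 ht)) hcq,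
        padicValRat.mul hq0 (pow_ne_zero 2 ht), pow_two, padicValRat.mul ht ht, padicValRat.of_nat,
        padicValRat.of_nat]
      ring
    rw [hv, ← hsha]
    linarith

end Bookkeeping

end Summit.BirchSwinnertonDyer.Rank1Residual.Additive

/-! ## §4 Consequences -/

namespace Summit.BirchSwinnertonDyer.Rank1Residual

open Additive

variable {IsHullOf : ∀ (W : WeierstrassCurve ℚ) [W.IsElliptic] [W.IsGloballyMinimal] (p : ℕ)
  [Fact p.Prime], KatoHullDescentDatum p → Prop}
variable {KMC : ∀ (W : WeierstrassCurve ℚ) [W.IsElliptic] [W.IsGloballyMinimal] (p : ℕ), Prop}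

/-- **THE DEFECT IDENTITY at a realised member: `ord_p #Ш_an(W) = ord_p #Ш(W) + m(D)`** — from Reading
M3♯ at a hull-realised member `W` of analytic rank `0` (GZK for `Ш` finite / `Reg = 1`, modularity for
`L(W,1) ≠ 0`). Conditional over the displayed reading; nothing asserted.
[cite: Kato2004Asterisque, Prop. 14.16 (2) (p. 244)] [cite: Miller2011LMS, Def. 1.1] -/
theorem KatoHull.exists_shaAn_eq_of_reading (hC : KatoHull.ExactCountReading IsHullOf)
    (hGZK : rank_eq_analyticRank_of_analyticRank_le_one) (hmod : hasEntireLFunction_rat)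
    {W : WeierstrassCurve ℚ} [W.IsElliptic] [W.IsGloballyMinimal] {p : ℕ} [Fact p.Prime]
    {D : KatoHullDescentDatum p} (hp : p ≠ 2) (hadd : Addv W p) (hj : 0 ≤ padicValRat p W.j)
    (hr : W.analyticRank = 0) (hDof : IsHullOf W p D) :
    Finite (coinvariants p D.H2) ∧ D.yIndex ≠ 0 ∧
      ∃ q' : ℚ, shaAn W = (q' : ℂ) ∧ padicValRat p q' = (padicValNat p W.shaOrder : ℤ) + D.muExp := by
  have hL : W.entireLFunction 1 ≠ 0 := (W.analyticRank_eq_zero_iff_holds (hmod W)).mp hr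
  have hfin : Finite W.sha := (hGZK W (by rw [hr]; exact zero_le_one)).2
  obtain ⟨hfin2, hne, q, hq, hcount⟩ := hC W p D hp hadd hj hL hfin hDof
  refine ⟨hfin2, hne, ?_⟩
  have hcount' : (padicValNat p (Nat.card (AddCommGroup.primaryComponent W.sha p)) : ℤ) +
      padicValNat p W.tamagawaProduct + (padicValNat p D.yIndex : ℤ) =
      padicValRat p q + ((D.e : ℤ) + padicValNat p D.h2Card) +
        2 * (padicValNat p W.torsionOrder : ℤ) := by
    linarith
  obtain ⟨q', hq', hv⟩ := exists_shaAn_eq_of_exactCount W p hGZK hmod hr hq hcount'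
  refine ⟨q', hq', ?_⟩
  rw [hv]
  unfold KatoHullDescentDatum.muExp
  ring

/-- **THE UPPER HALF AT A REALISED MEMBER**: Reading M3♯ + the divisibility for the hull at `D` give
`ord_p #Ш(W) ≤ ord_p #Ш_an(W)` (`MissingUpperBoundAt W p`) at the member `W` ITSELF, with no torsion
slack: `ord_p #Ш_an = ord_p #Ш + m` and `m ≥ 0` (part 11). Conditional over displayed readings.
[cite: Kato2004Asterisque, Thm. 14.5 (3) (p. 236), Prop. 14.16 (2) (p. 244)] [cite: Wuthrich2014, Lemma 14 (p. 396)] -/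
theorem KatoHull.missingUpperBoundAt_of_exactCount (hC : KatoHull.ExactCountReading IsHullOf)
    (hGZK : rank_eq_analyticRank_of_analyticRank_le_one) (hmod : hasEntireLFunction_rat)
    {W : WeierstrassCurve ℚ} [W.IsElliptic] [W.IsGloballyMinimal] {p : ℕ} [Fact p.Prime]
    {D : KatoHullDescentDatum p} (hp : p ≠ 2) (hadd : Addv W p) (hj : 0 ≤ padicValRat p W.j)
    (hr : W.analyticRank = 0) (hDof : IsHullOf W p D) (hdiv : D.HullDivisibility) :
    MissingUpperBoundAt W p := by
  obtain ⟨hfin2, hne, q', hq', hv⟩ := KatoHull.exists_shaAn_eq_of_reading hC hGZK hmod hp hadd hj hr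
    hDof
  have hm : 0 ≤ D.muExp := D.muExp_nonneg_of_hullDivisibility hdiv hfin2 hne
  exact ⟨q', hq', by rw [hv]; linarith⟩

/-- **KMC ⇒ BSD_p AT A REALISED MEMBER** (any torsion, any image): Kato's Main Conjecture read on a
realised hull datum of `W` (`ReadsKMC`) and Reading M3♯ give `BSDp W p` in analytic rank `0` —
`Conj1210 ⇒ m = 0 ⇒ ord_p #Ш_an = ord_p #Ш`. No divisibility, no torsion-free member, no isogeny
transport. Conditional over displayed readings; nothing asserted.
[cite: Kato2004Asterisque, Conj. 12.10 (p. 224), §14.14 (p. 243), Prop. 14.16 (2) (p. 244)] [cite: Miller2011LMS, Def. 1.1] -/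
theorem KatoHull.bsdp_of_kmc (hC : KatoHull.ExactCountReading IsHullOf)
    (hK : KatoHull.ReadsKMC IsHullOf KMC) (hGZK : rank_eq_analyticRank_of_analyticRank_le_one)
    (hmod : hasEntireLFunction_rat)
    {W : WeierstrassCurve ℚ} [W.IsElliptic] [W.IsGloballyMinimal] {p : ℕ} [Fact p.Prime]
    {D : KatoHullDescentDatum p} (hp : p ≠ 2) (hadd : Addv W p) (hj : 0 ≤ padicValRat p W.j)
    (hr : W.analyticRank = 0) (hDof : IsHullOf W p D) (hkmc : KMC W p) : BSDp W p := by
  obtain ⟨hfin2, hne, q', hq', hv⟩ := KatoHull.exists_shaAn_eq_of_reading hC hGZK hmod hp hadd hj hr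
    hDof
  have hm : D.muExp = 0 := D.muExp_eq_zero_of_conj1210 ((hK W p D hDof).mp hkmc) hfin2 hne
  rw [hm, add_zero] at hv
  exact bsdp_of_missingPPartAt W p hGZK (by rw [hr]; exact zero_le_one) ⟨q', hq', hv⟩

/-- **BSD_p ⇒ KMC AT A REALISED MEMBER**, granted the divisibility for the hull at the datum:
`ord_p #Ш_an = ord_p #Ш + m` and BSD_p force `m = 0`, and `m = 0` with the divisibility is Conj. 12.10
(the converse descent through the hull). Conditional over displayed readings; nothing asserted.
[cite: Kato2004Asterisque, Thm. 12.5 (3)–(4) (p. 222), Conj. 12.10 (p. 224), Prop. 14.16 (2) (p. 244)] -/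
theorem KatoHull.kmc_of_bsdp (hC : KatoHull.ExactCountReading IsHullOf)
    (hK : KatoHull.ReadsKMC IsHullOf KMC) (hGZK : rank_eq_analyticRank_of_analyticRank_le_one)
    (hmod : hasEntireLFunction_rat)
    {W : WeierstrassCurve ℚ} [W.IsElliptic] [W.IsGloballyMinimal] {p : ℕ} [Fact p.Prime]
    {D : KatoHullDescentDatum p} (hp : p ≠ 2) (hadd : Addv W p) (hj : 0 ≤ padicValRat p W.j)
    (hr : W.analyticRank = 0) (hDof : IsHullOf W p D) (hdiv : D.HullDivisibility) (h : BSDp W p) :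
    KMC W p := by
  obtain ⟨hfin2, hne, q', hq', hv⟩ := KatoHull.exists_shaAn_eq_of_reading hC hGZK hmod hp hadd hj hr
    hDof
  haveI : Finite W.sha := (hGZK W (by rw [hr]; exact zero_le_one)).2
  obtain ⟨q, hq, hvq⟩ := missingPPartAt_of_bsdp W p h
  have hqq : q' = q := by exact_mod_cast hq'.symm.trans hq
  subst hqq
  have hm : D.muExp = 0 := by rw [hvq] at hv; linarith
  exact (hK W p D hDof).mpr (D.conj1210_of_muExp_eq_zero hdiv hfin2 hne hm)

/-- **`KMC_p(W) ⟺ BSD_p(W)` at every hull-realised member of analytic rank `0`**, granted the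
divisibility for the hull at the datum. Conditional over displayed readings; nothing asserted.
[cite: Kato2004Asterisque, Conj. 12.10 (p. 224), Thm. 14.5 (3) (p. 236), Prop. 14.16 (2) (p. 244)] -/
theorem KatoHull.kmc_iff_bsdp (hC : KatoHull.ExactCountReading IsHullOf)
    (hK : KatoHull.ReadsKMC IsHullOf KMC) (hGZK : rank_eq_analyticRank_of_analyticRank_le_one)
    (hmod : hasEntireLFunction_rat)
    {W : WeierstrassCurve ℚ} [W.IsElliptic] [W.IsGloballyMinimal] {p : ℕ} [Fact p.Prime]
    {D : KatoHullDescentDatum p} (hp : p ≠ 2) (hadd : Addv W p) (hj : 0 ≤ padicValRat p W.j)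
    (hr : W.analyticRank = 0) (hDof : IsHullOf W p D) (hdiv : D.HullDivisibility) :
    KMC W p ↔ BSDp W p :=
  ⟨KatoHull.bsdp_of_kmc hC hK hGZK hmod hp hadd hj hr hDof,
    KatoHull.kmc_of_bsdp hC hK hGZK hmod hp hadd hj hr hDof hdiv⟩

end Summit.BirchSwinnertonDyer.Rank1Residual

end
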